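import Summits.Ventures.YMGap.YM3IR.Statement
import Summits.Ventures.YMGap.YM3IR.CovarianceLemmas
import Summits.Ventures.YMGap.YM3IR.CoarseGeometry
import Literature.MathematicalPhysics.QuantumFieldTheory.LatticeGaugeProofs
import HarnessLib

/-!
# YM₃ infrared statement — PROOF of the support hypothesis `DecayTransfer`
# (cell `pub-ymgap`, track Y4; statement by ym3ir-theory-2 in `YM3IR/Statement.lean`, proof by ds-1)

HONEST FRAMING.  This file PROVES the one hypothesis of `T_IR` that `YM3IR/Statement.lean` labels SUPPORT
(«elementary, to be PROVED»): `YM3IR.DecayTransfer r ρ W I m_c κ` — volume-uniform clustering of the COARSE laws at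
rate `m_c` plus `FluctuationDecouplingAt` at `(β, κ)` give volume-uniform clustering of the FINE Wilson laws on the
block family's own tori at rate `min(m_c, κ)/(3 b(β))`.  It is pure probability bookkeeping (law of total covariance +
quasi-locality + the block geometry); it proves NOTHING about Yang–Mills beyond that implication: the conjectures
`Crossover3` / `FluctuationDecoupling` and the target `MassGap3Cofinal` are untouched.  Hypotheses added to the bare
predicate: `Continuous ρ` (so that the Wilson laws are probability measures — true for every `GroupModel`), `0 ≤ κ`,
`0 ≤ m_c` (the composition `massGap3Cofinal_of` has `0 < κ`, `0 < m_c`).  Consequences recorded at the end: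
`t_IR_of_irConjecture3` (`IRConjecture3 → T_IR`) and `massGap3Cofinal_of_irConjecture3`
(`BalabanUV3 ∧ ClusterDomainClustering ∧ IRConjecture3 ⟹ MassGap3Cofinal I`): after this file the composition rests
on IN-PRINT + Y2 + ONE named conjecture only.  No axiom, no `sorry`, `0` compute.

MECHANISM (as announced in the docstring of `DecayTransfer`).  Fix `β ∈ I`, `b = b(β)`, a fine torus of side `bM`,
`M ≥ 3`, observables `f, g` with supports `Δf, Δg` at fine distance `≥ n` and Lipschitz loads `δf, δg`; `μ` = the fine
Wilson law, `V = blk U` the coarse field, `m = min(m_c, κ)/(3b)`, `R = ⌊n/(3b)⌋`.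
(1) Law of total covariance (`covariance_eq_integral_condCov_add`): `cov(f,g) = E[condCov] + cov(E[f|V], E[g|V])`.
(2) `|E[condCov]| ≤ c ΣδfΣδg e^{−κn/b} ≤ c ΣδfΣδg e^{−mn}` (`FluctuationDecouplingAt` (i)).
(3) Quasi-locality (ii): `E[f|V] = h_f∘blk + D_f`, `|D_f| ≤ cΣδf e^{−κR}` a.s., `Σδh_f ≤ cΣδf`, `Δh_f ⊆ hull_R(Δf)`; same
    for `g`.  Then `cov(E[f|V], E[g|V]) = cov(D_f, E[g|V]) + cov(h_f∘blk, D_g) + cov(h_f∘blk, h_g∘blk)`; the two cross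
    terms are `≤ 2·(cΣδ·e^{−κR})·(width)` by `abs_covariance_le_of_abs_le`, the widths being oscillations
    `≤ D·Σδ` (`IsLipBound.abs_sub_le_mul_sum_of_dependsOn`, `r ≤ D`), and `e^{−κR} ≤ e^{κ} e^{−mn}`.
(4) `cov_μ(h_f∘blk, h_g∘blk) = cov_{μ.map blk}(h_f, h_g)` (Mathlib `covariance_map`) and `μ.map blk` IS the coarse law,
    whose clustering at coarse separation `n_c = ⌊(n+1)/b⌋ − 2R − 1 ≥ n/(3b) − 2` (`CoarseGeometry.le_blockSeparation`)
    gives `≤ A_c c² ΣδfΣδg e^{2m_c} e^{−mn}`.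
Constant: `A = c₀ + 4c₀D₀e^{κ}(1 + c₀) + A₀c₀²e^{2m_c}` (`c₀ = max c 0`, `D₀ = max D 0`, `A₀ = max A_c 0`), uniform in `M`.

References: Föllmer, LNM 1362 (1988) Ch. I (2.17)–(2.22); Bałaban–O'Carroll, CMP 199 (1999) (method template only);
cell files YM3-IR.md / YM3-IR-theory2.md.
-/

noncomputable section

open MeasureTheory ProbabilityTheory Filter Finset
open Literature.Probability.LatticeModels Literature.Probability.LatticeModels.DobrushinMetric
open Literature.MathematicalPhysics.QuantumLattice Literature.MathematicalPhysics.QuantumFieldTheory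

namespace Summit.Ventures.YMGap.YM3IR.DecayTransferProof

/-! ### Small measure-theoretic helpers -/

section Helpers

variable {Ω : Type*} [MeasurableSpace Ω] {μ : Measure Ω}

/-- `|∫ h| ≤ C` when `|h| ≤ C` a.e. on a probability space (`C ≥ 0`; no integrability needed: a
non-integrable `h` has integral `0`). [folklore] -/
theorem abs_integral_le_of_ae_abs_le [IsProbabilityMeasure μ] {h : Ω → ℝ} {C : ℝ} (hC : 0 ≤ C)
    (hh : ∀ᵐ x ∂μ, |h x| ≤ C) : |∫ x, h x ∂μ| ≤ C := by
  by_cases hi : Integrable h μ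
  · calc |∫ x, h x ∂μ| ≤ ∫ x, |h x| ∂μ := abs_integral_le_integral_abs
      _ ≤ ∫ _, C ∂μ := integral_mono_ae hi.abs (integrable_const C) hh
      _ = C := by simp
  · rw [integral_undef hi, abs_zero]; exact hC

/-- A bounded measurable real function on a finite measure space is in `L²` (everywhere-bound form). [folklore] -/
theorem memLp_two_of_bound [IsFiniteMeasure μ] {f : Ω → ℝ} (hf : Measurable f) {C : ℝ} (hC : ∀ x, |f x| ≤ C) :
    MemLp f 2 μ :=
  memLp_two_of_ae_bound hf.aestronglyMeasurable (ae_of_all _ hC)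

end Helpers

/-! ### The oscillation of a coordinatewise-Lipschitz cylinder function -/

section Osc

variable {V S : Type*}

/-- A cylinder function with Lipschitz loads `δ` for a weight `r ≤ D` takes all its values in the interval
`[f σ₀ − D₀ Σδ, f σ₀ + D₀ Σδ]`, `D₀ = max D 0` (Föllmer's interpolation bound). [folklore] -/
theorem mem_interval_of_isLipBound [DecidableEq V] {r : S → S → ℝ} {D : ℝ} (hD : ∀ a b, r a b ≤ D)
    {f : (V → S) → ℝ} {Δ : Finset V} {δ : V → ℝ} (hdep : DependsOn f (↑Δ : Set V)) (hδ : IsLipBound r f δ)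
    (σ₀ σ : V → S) :
    f σ₀ - max D 0 * ∑ y ∈ Δ, δ y ≤ f σ ∧ f σ ≤ f σ₀ + max D 0 * ∑ y ∈ Δ, δ y := by
  have hD' : ∀ a b, r a b ≤ max D 0 := fun a b => (hD a b).trans (le_max_left _ _)
  have h := abs_sub_le_mul_sum_of_dependsOn hD' hdep hδ σ σ₀
  rw [abs_le] at h
  constructor <;> linarith [h.1, h.2]

end Osc

/-! ### The theorem -/

section Main

variable {G : Type} [MeasurableSpace G] {N : ℕ} [Group G] [TopologicalSpace G] [IsTopologicalGroup G]
  [CompactSpace G] [BorelSpace G]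

/-- **`DecayTransfer` holds — core form** (nonnegative rates `κ, m_c`; every fine Wilson law a probability measure OR
the zero measure, which is always the case: `decayTransfer` below for continuous `ρ`): volume-uniform clustering of the
coarse laws at rate `m_c` and `FluctuationDecouplingAt r ρ W β κ` give `FineUniformClustering r ρ β W (min m_c κ / (3 b(β)))`
— law of total covariance, quasi-locality of the conditional expectations, push-forward of the covariance to the coarse
law, block geometry.  See the module docstring for the constant. [folklore] -/
theorem decayTransfer_of {ρ : G →* Matrix (Fin N) (Fin N) ℂ} {r : G → G → ℝ} {W : BlockFamily G} {I : Set ℝ}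
    {m_c κ : ℝ}
    (hP : ∀ (β : ℝ) (M : ℕ) [NeZero M], IsProbabilityMeasure (fineLaw ρ β W M) ∨ fineLaw ρ β W M = 0)
    (hκ : 0 ≤ κ) (hmc : 0 ≤ m_c) : DecayTransfer r ρ W I m_c κ := by
  classical
  rintro ⟨D, hD⟩ β hβ ⟨A_c, hcoarse⟩ ⟨c, hfl⟩
  -- the block factor and the rate
  have hb : 0 < W.factor β := W.factor_pos β
  have hbR : (0 : ℝ) < (W.factor β : ℝ) := by exact_mod_cast hb
  set m : ℝ := min m_c κ / (3 * (W.factor β : ℝ)) with hm_def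
  -- normalised constants
  set c₀ : ℝ := max c 0 with hc₀
  set D₀ : ℝ := max D 0 with hD₀
  set A₀ : ℝ := max A_c 0 with hA₀
  have hc₀0 : 0 ≤ c₀ := le_max_right _ _
  have hD₀0 : 0 ≤ D₀ := le_max_right _ _
  have hA₀0 : 0 ≤ A₀ := le_max_right _ _
  have hcc₀ : c ≤ c₀ := le_max_left _ _
  have hDD₀ : ∀ a b, r a b ≤ D₀ := fun a b => (hD a b).trans (le_max_left _ _)
  refine ⟨c₀ + 4 * c₀ * D₀ * Real.exp κ * (1 + c₀) + A₀ * c₀ ^ 2 * Real.exp (2 * m_c), fun M _ hM => ?_⟩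
  intro f g Δf Δg δf δg n hfm hgm hfd hgd hfb hgb hfl' hgl hdist
  -- sums of loads are nonnegative; the constant is nonnegative
  have hSf0' : 0 ≤ ∑ x ∈ Δf, δf x := sum_nonneg fun x _ => hfl'.nonneg x
  have hSg0' : 0 ≤ ∑ y ∈ Δg, δg y := sum_nonneg fun y _ => hgl.nonneg y
  have hA0 : 0 ≤ c₀ + 4 * c₀ * D₀ * Real.exp κ * (1 + c₀) + A₀ * c₀ ^ 2 * Real.exp (2 * m_c) := by positivity
  -- the fine law is a probability measure (or zero, in which case every covariance vanishes)
  set μ : Measure (GaugeConfig 3 (W.factor β * M) G) := fineLaw ρ β W M with hμ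
  rcases hP β M with hPM | hzero
  swap
  · have hcov : cov[f, g; μ] = 0 := by rw [hμ, hzero]; simp [covariance]
    rw [hcov, abs_zero]; positivity
  haveI : IsProbabilityMeasure μ := hPM
  -- the coarse σ-algebra
  have hmle : coarseSigma W β M ≤ (inferInstance : MeasurableSpace (GaugeConfig 3 (W.factor β * M) G)) :=
    (W.measurable_blk β M).comap_le
  -- sums of loads
  set Sf : ℝ := ∑ x ∈ Δf, δf x with hSf
  set Sg : ℝ := ∑ y ∈ Δg, δg y with hSg
  have hSf0 : 0 ≤ Sf := sum_nonneg fun x _ => hfl'.nonneg x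
  have hSg0 : 0 ≤ Sg := sum_nonneg fun y _ => hgl.nonneg y
  obtain ⟨Cf, hCf⟩ := hfb
  obtain ⟨Cg, hCg⟩ := hgb
  -- the fluctuation hypotheses at this volume
  obtain ⟨hfl1, hfl2⟩ := hfl M
  -- (1) law of total covariance
  have hLTC := covariance_eq_integral_condCov_add (μ := μ) hmle hfm.aestronglyMeasurable hgm.aestronglyMeasurable
    (ae_of_all _ hCf) (ae_of_all _ hCg)
  -- (2) the conditional-covariance term
  have hT1 : |∫ U, ((μ[f * g|coarseSigma W β M]) U - (μ[f|coarseSigma W β M]) U * (μ[g|coarseSigma W β M]) U) ∂μ|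
      ≤ c₀ * Sf * Sg * Real.exp (-m * n) := by
    have hae := hfl1 f g Δf Δg δf δg n hfm hgm hfd hgd ⟨Cf, hCf⟩ ⟨Cg, hCg⟩ hfl' hgl hdist
    have hn0 : (0 : ℝ) ≤ n := Nat.cast_nonneg n
    have hexp : Real.exp (-κ * n / W.factor β) ≤ Real.exp (-m * n) := by
      refine Real.exp_le_exp.2 ?_
      have hmk : m ≤ κ / (W.factor β : ℝ) :=
        calc m = min m_c κ / (3 * (W.factor β : ℝ)) := rfl
          _ ≤ κ / (3 * (W.factor β : ℝ)) := div_le_div_of_nonneg_right (min_le_right _ _) (by positivity)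
          _ ≤ κ / (W.factor β : ℝ) := div_le_div_of_nonneg_left hκ hbR (by linarith)
      have h1 : m * n ≤ κ / (W.factor β : ℝ) * n := mul_le_mul_of_nonneg_right hmk hn0
      have e : -κ * (n : ℝ) / (W.factor β : ℝ) = -(κ / (W.factor β : ℝ) * n) := by ring
      rw [e]; linarith
    have hbound : ∀ᵐ U ∂μ, |(μ[f * g|coarseSigma W β M]) U - (μ[f|coarseSigma W β M]) U * (μ[g|coarseSigma W β M]) U|
        ≤ c₀ * Sf * Sg * Real.exp (-m * n) := by
      filter_upwards [hae] with U hU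
      calc |(μ[f * g|coarseSigma W β M]) U - (μ[f|coarseSigma W β M]) U * (μ[g|coarseSigma W β M]) U|
          = |condCov W β M μ f g U| := rfl
        _ ≤ c * Sf * Sg * Real.exp (-κ * n / W.factor β) := hU
        _ ≤ c₀ * Sf * Sg * Real.exp (-κ * n / W.factor β) :=
            mul_le_mul_of_nonneg_right (mul_le_mul_of_nonneg_right (mul_le_mul_of_nonneg_right hcc₀ hSf0) hSg0)
              (Real.exp_pos _).le
        _ ≤ c₀ * Sf * Sg * Real.exp (-m * n) :=
            mul_le_mul_of_nonneg_left hexp (mul_nonneg (mul_nonneg hc₀0 hSf0) hSg0)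
    exact abs_integral_le_of_ae_abs_le (by positivity) hbound
  -- (3) quasi-locality at radius `R = ⌊n/(3b)⌋`
  set R : ℕ := n / (3 * W.factor β) with hR
  obtain ⟨hf_, Δhf, δhf, hhfm, hhfd, hhfsub, ⟨Chf, hChf⟩, hhfl, hhfsum, hhfae⟩ :=
    hfl2 f Δf δf R hfm hfd ⟨Cf, hCf⟩ hfl'
  obtain ⟨hg_, Δhg, δhg, hhgm, hhgd, hhgsub, ⟨Chg, hChg⟩, hhgl, hhgsum, hhgae⟩ :=
    hfl2 g Δg δg R hgm hgd ⟨Cg, hCg⟩ hgl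
  -- names for the four random variables
  set F : GaugeConfig 3 (W.factor β * M) G → ℝ := μ[f|coarseSigma W β M] with hF
  set Gc : GaugeConfig 3 (W.factor β * M) G → ℝ := μ[g|coarseSigma W β M] with hGc
  set Hf : GaugeConfig 3 (W.factor β * M) G → ℝ := fun U => hf_ (W.blk β M U) with hHf
  set Hg : GaugeConfig 3 (W.factor β * M) G → ℝ := fun U => hg_ (W.blk β M U) with hHg
  -- measurability / L² facts
  have hFm : AEStronglyMeasurable F μ := (stronglyMeasurable_condExp.mono hmle).aestronglyMeasurable
  have hGm : AEStronglyMeasurable Gc μ := (stronglyMeasurable_condExp.mono hmle).aestronglyMeasurable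
  have hFb : ∀ᵐ U ∂μ, |F U| ≤ Cf := ae_bdd_abs_condExp_of_ae_bdd_abs (ae_of_all _ hCf)
  have hGb : ∀ᵐ U ∂μ, |Gc U| ≤ Cg := ae_bdd_abs_condExp_of_ae_bdd_abs (ae_of_all _ hCg)
  have hF2 : MemLp F 2 μ := memLp_two_of_ae_bound hFm hFb
  have hG2 : MemLp Gc 2 μ := memLp_two_of_ae_bound hGm hGb
  have hHfmeas : Measurable Hf := hhfm.comp (W.measurable_blk β M)
  have hHgmeas : Measurable Hg := hhgm.comp (W.measurable_blk β M)
  have hHf2 : MemLp Hf 2 μ := memLp_two_of_bound hHfmeas (fun U => hChf _)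
  have hHg2 : MemLp Hg 2 μ := memLp_two_of_bound hHgmeas (fun U => hChg _)
  -- the decomposition `cov(F, G) = cov(F − Hf, G) + cov(Hf, G − Hg) + cov(Hf, Hg)`
  have hsplit : cov[F, Gc; μ] = cov[F - Hf, Gc; μ] + cov[Hf, Gc - Hg; μ] + cov[Hf, Hg; μ] := by
    rw [covariance_sub_left hF2 hHf2 hG2, covariance_sub_right hHf2 hG2 hHg2]; ring
  -- widths
  obtain ⟨U₀⟩ : Nonempty (GaugeConfig 3 (W.factor β * M) G) := ⟨fun _ => 1⟩
  have hgI : ∀ U, g U₀ - D₀ * Sg ≤ g U ∧ g U ≤ g U₀ + D₀ * Sg := fun U => by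
    have := mem_interval_of_isLipBound hD hgd hgl U₀ U; rwa [← hD₀] at this
  have hGI : ∀ᵐ U ∂μ, g U₀ - D₀ * Sg ≤ Gc U ∧ Gc U ≤ g U₀ + D₀ * Sg :=
    condExp_mem_Icc_ae hmle ((memLp_two_of_bound hgm hCg).integrable one_le_two) (ae_of_all _ hgI)
  have hHfI : ∀ U, hf_ (W.blk β M U₀) - D₀ * (c₀ * Sf) ≤ Hf U ∧ Hf U ≤ hf_ (W.blk β M U₀) + D₀ * (c₀ * Sf) := by
    intro U
    have h := mem_interval_of_isLipBound hD hhfd hhfl (W.blk β M U₀) (W.blk β M U)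
    rw [← hD₀] at h
    have hs : max D 0 * ∑ y ∈ Δhf, δhf y ≤ D₀ * (c₀ * Sf) := by
      rw [← hD₀]
      exact mul_le_mul_of_nonneg_left (hhfsum.trans (mul_le_mul_of_nonneg_right hcc₀ hSf0)) hD₀0
    exact ⟨by linarith [h.1], by linarith [h.2]⟩
  -- (3a) the cross term `cov(F − Hf, G)`
  have h3b : (0 : ℝ) < 3 * (W.factor β : ℝ) := by positivity
  have hR1 : (n : ℝ) / (3 * (W.factor β : ℝ)) - 1 ≤ (R : ℝ) := by
    have h1 : n < (n / (3 * W.factor β) + 1) * (3 * W.factor β) := by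
      rw [add_mul, one_mul]; exact Nat.lt_div_mul_add (by omega)
    have h2 : (n : ℝ) < ((R : ℝ) + 1) * (3 * (W.factor β : ℝ)) := by rw [hR]; exact_mod_cast h1
    have h3 : (n : ℝ) / (3 * (W.factor β : ℝ)) < (R : ℝ) + 1 := by rwa [div_lt_iff₀ h3b]
    linarith
  have hRle : (R : ℝ) ≤ (n : ℝ) / (3 * (W.factor β : ℝ)) := by
    rw [le_div_iff₀ h3b, hR]; exact_mod_cast Nat.div_mul_le_self n (3 * W.factor β)
  have hmn3 : m * n ≤ min m_c κ * ((n : ℝ) / (3 * (W.factor β : ℝ))) := by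
    have e : m * n = min m_c κ * ((n : ℝ) / (3 * (W.factor β : ℝ))) := by
      rw [hm_def]; field_simp
    rw [e]
  have hn3 : (0 : ℝ) ≤ (n : ℝ) / (3 * (W.factor β : ℝ)) := by positivity
  have hmkκ : m * n ≤ κ * ((n : ℝ) / (3 * (W.factor β : ℝ))) :=
    hmn3.trans (mul_le_mul_of_nonneg_right (min_le_right _ _) hn3)
  have hmkc : m * n ≤ m_c * ((n : ℝ) / (3 * (W.factor β : ℝ))) :=
    hmn3.trans (mul_le_mul_of_nonneg_right (min_le_left _ _) hn3)
  have hexpR : Real.exp (-κ * R) ≤ Real.exp κ * Real.exp (-m * n) := by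
    rw [← Real.exp_add]
    refine Real.exp_le_exp.2 ?_
    have := mul_le_mul_of_nonneg_left hR1 hκ
    linarith [hmkκ]
  have hT2 : |cov[F - Hf, Gc; μ]| ≤ 2 * (c₀ * Sf * (Real.exp κ * Real.exp (-m * n))) * (2 * (D₀ * Sg)) := by
    have hDf : ∀ᵐ U ∂μ, |(F - Hf) U| ≤ c₀ * Sf * (Real.exp κ * Real.exp (-m * n)) := by
      filter_upwards [hhfae] with U hU
      calc |(F - Hf) U| = |(μ[f|coarseSigma W β M]) U - hf_ (W.blk β M U)| := rfl
        _ ≤ c * Sf * Real.exp (-κ * R) := hU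
        _ ≤ c₀ * Sf * Real.exp (-κ * R) :=
            mul_le_mul_of_nonneg_right (mul_le_mul_of_nonneg_right hcc₀ hSf0) (Real.exp_pos _).le
        _ ≤ c₀ * Sf * (Real.exp κ * Real.exp (-m * n)) := mul_le_mul_of_nonneg_left hexpR (mul_nonneg hc₀0 hSf0)
    have h := abs_covariance_le_of_abs_le (hFm.sub hHfmeas.aestronglyMeasurable) hGm hDf hGI
    calc |cov[F - Hf, Gc; μ]| ≤ 2 * (c₀ * Sf * (Real.exp κ * Real.exp (-m * n))) *
          (g U₀ + D₀ * Sg - (g U₀ - D₀ * Sg)) := h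
      _ = 2 * (c₀ * Sf * (Real.exp κ * Real.exp (-m * n))) * (2 * (D₀ * Sg)) := by ring
  -- (3b) the cross term `cov(Hf, G − Hg)`
  have hT3 : |cov[Hf, Gc - Hg; μ]| ≤ 2 * (c₀ * Sg * (Real.exp κ * Real.exp (-m * n))) * (2 * (D₀ * (c₀ * Sf))) := by
    have hDg : ∀ᵐ U ∂μ, |(Gc - Hg) U| ≤ c₀ * Sg * (Real.exp κ * Real.exp (-m * n)) := by
      filter_upwards [hhgae] with U hU
      calc |(Gc - Hg) U| = |(μ[g|coarseSigma W β M]) U - hg_ (W.blk β M U)| := rfl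
        _ ≤ c * Sg * Real.exp (-κ * R) := hU
        _ ≤ c₀ * Sg * Real.exp (-κ * R) :=
            mul_le_mul_of_nonneg_right (mul_le_mul_of_nonneg_right hcc₀ hSg0) (Real.exp_pos _).le
        _ ≤ c₀ * Sg * (Real.exp κ * Real.exp (-m * n)) := mul_le_mul_of_nonneg_left hexpR (mul_nonneg hc₀0 hSg0)
    have h := abs_covariance_le_of_abs_le (hGm.sub hHgmeas.aestronglyMeasurable) hHfmeas.aestronglyMeasurable hDg
      (ae_of_all _ hHfI)
    rw [covariance_comm] at h
    calc |cov[Hf, Gc - Hg; μ]| ≤ 2 * (c₀ * Sg * (Real.exp κ * Real.exp (-m * n))) *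
          (hf_ (W.blk β M U₀) + D₀ * (c₀ * Sf) - (hf_ (W.blk β M U₀) - D₀ * (c₀ * Sf))) := h
      _ = 2 * (c₀ * Sg * (Real.exp κ * Real.exp (-m * n))) * (2 * (D₀ * (c₀ * Sf))) := by ring
  -- (4) the main term: push forward to the coarse law
  have hmap : cov[Hf, Hg; μ] = cov[hf_, hg_; coarseFamily ρ β W M] := by
    have e : coarseFamily ρ β W M = μ.map (W.blk β M) := rfl
    rw [e, covariance_map hhfm.aestronglyMeasurable hhgm.aestronglyMeasurable (W.measurable_blk β M).aemeasurable]
    rfl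
  -- coarse separation
  set nc : ℕ := (n + 1) / W.factor β - (2 * R + 1) with hnc
  have hsep : ∀ y ∈ Δhf, ∀ y' ∈ Δhg, nc ≤ torusNorm (y.1 - y'.1) := by
    intro y hy y' hy'
    obtain ⟨x, hx, hxR⟩ := hhfsub (Finset.mem_coe.2 hy)
    obtain ⟨x', hx', hx'R⟩ := hhgsub (Finset.mem_coe.2 hy')
    have key := le_blockSeparation hb (hdist x hx x' hx') hxR hx'R
    have hb1 : 1 ≤ W.factor β := hb
    have h1 : n + 1 ≤ W.factor β * (torusNorm (y.1 - y'.1) + 2 * R + 1) := by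
      zify [hb1] at key ⊢
      linarith
    have h2 : (n + 1) / W.factor β ≤ torusNorm (y.1 - y'.1) + 2 * R + 1 := Nat.div_le_of_le_mul h1
    rw [hnc]
    generalize (n + 1) / W.factor β = q at h2 ⊢
    omega
  have hT4 : |cov[Hf, Hg; μ]| ≤ A₀ * (c₀ * Sf) * (c₀ * Sg) * (Real.exp (2 * m_c) * Real.exp (-m * n)) := by
    rw [hmap]
    have h := hcoarse M hM hf_ hg_ Δhf Δhg δhf δhg nc hhfm hhgm hhfd hhgd ⟨Chf, hChf⟩ ⟨Chg, hChg⟩ hhfl hhgl hsep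
    have hShf0 : 0 ≤ ∑ y ∈ Δhf, δhf y := sum_nonneg fun y _ => hhfl.nonneg y
    have hShg0 : 0 ≤ ∑ y ∈ Δhg, δhg y := sum_nonneg fun y _ => hhgl.nonneg y
    have hShf : ∑ y ∈ Δhf, δhf y ≤ c₀ * Sf := hhfsum.trans (mul_le_mul_of_nonneg_right hcc₀ hSf0)
    have hShg : ∑ y ∈ Δhg, δhg y ≤ c₀ * Sg := hhgsum.trans (mul_le_mul_of_nonneg_right hcc₀ hSg0)
    -- the coarse rate: `m_c · nc ≥ m n − 2 m_c`
    have hexpc : Real.exp (-m_c * nc) ≤ Real.exp (2 * m_c) * Real.exp (-m * n) := by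
      rw [← Real.exp_add]
      refine Real.exp_le_exp.2 ?_
      -- `nc ≥ (n+1)/b − 2R − 2 ≥ n/(3b) − 2`
      have hq : ((n : ℝ) + 1) / (W.factor β : ℝ) - 1 ≤ (((n + 1) / W.factor β : ℕ) : ℝ) := by
        have h1 : n + 1 < ((n + 1) / W.factor β + 1) * W.factor β := by
          rw [add_mul, one_mul]; exact Nat.lt_div_mul_add hb
        have h2 : ((n : ℝ) + 1) < ((((n + 1) / W.factor β : ℕ) : ℝ) + 1) * (W.factor β : ℝ) := by
          exact_mod_cast h1
        have h3 : ((n : ℝ) + 1) / (W.factor β : ℝ) < (((n + 1) / W.factor β : ℕ) : ℝ) + 1 := by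
          rwa [div_lt_iff₀ hbR]
        linarith
      have hsub : (((n + 1) / W.factor β : ℕ) : ℝ) - (2 * (R : ℝ) + 1) ≤ (nc : ℝ) := by
        have h0 := le_tsub_add (a := 2 * R + 1) (b := (n + 1) / W.factor β)
        have hcast : ((((n + 1) / W.factor β : ℕ)) : ℝ) ≤ (nc : ℝ) + (2 * (R : ℝ) + 1) := by
          rw [hnc]; exact_mod_cast h0
        linarith
      have hn1 : (n : ℝ) / (3 * (W.factor β : ℝ)) ≤
          ((n : ℝ) + 1) / (W.factor β : ℝ) - 2 * ((n : ℝ) / (3 * (W.factor β : ℝ))) := by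
        have e : ((n : ℝ) + 1) / (W.factor β : ℝ) = 3 * ((n : ℝ) / (3 * (W.factor β : ℝ))) + 1 / (W.factor β : ℝ) := by
          rw [← mul_div_assoc, mul_div_mul_left (n : ℝ) (W.factor β : ℝ) (by norm_num : (3 : ℝ) ≠ 0), add_div]
        rw [e]
        have h10 : (0 : ℝ) ≤ 1 / (W.factor β : ℝ) := by positivity
        linarith
      have hnc_ge : (n : ℝ) / (3 * (W.factor β : ℝ)) - 2 ≤ (nc : ℝ) := by linarith
      have := mul_le_mul_of_nonneg_left hnc_ge hmc
      linarith [hmkc]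
    have hE0 : 0 ≤ Real.exp (-m_c * (nc : ℝ)) := (Real.exp_pos _).le
    calc |cov[hf_, hg_; coarseFamily ρ β W M]|
        ≤ A_c * (∑ y ∈ Δhf, δhf y) * (∑ y ∈ Δhg, δhg y) * Real.exp (-m_c * nc) := h
      _ ≤ A₀ * (∑ y ∈ Δhf, δhf y) * (∑ y ∈ Δhg, δhg y) * Real.exp (-m_c * nc) :=
          mul_le_mul_of_nonneg_right (mul_le_mul_of_nonneg_right
            (mul_le_mul_of_nonneg_right (le_max_left _ _) hShf0) hShg0) hE0
      _ ≤ A₀ * (c₀ * Sf) * (c₀ * Sg) * Real.exp (-m_c * nc) := by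
          refine mul_le_mul_of_nonneg_right ?_ hE0
          exact mul_le_mul (mul_le_mul_of_nonneg_left hShf hA₀0) hShg hShg0
            (mul_nonneg hA₀0 (mul_nonneg hc₀0 hSf0))
      _ ≤ A₀ * (c₀ * Sf) * (c₀ * Sg) * (Real.exp (2 * m_c) * Real.exp (-m * n)) :=
          mul_le_mul_of_nonneg_left hexpc
            (mul_nonneg (mul_nonneg hA₀0 (mul_nonneg hc₀0 hSf0)) (mul_nonneg hc₀0 hSg0))
  -- (5) assemble
  calc |cov[f, g; μ]|
      = |(∫ U, ((μ[f * g|coarseSigma W β M]) U - (μ[f|coarseSigma W β M]) U * (μ[g|coarseSigma W β M]) U) ∂μ)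
          + cov[F, Gc; μ]| := by rw [hLTC]
    _ ≤ |∫ U, ((μ[f * g|coarseSigma W β M]) U - (μ[f|coarseSigma W β M]) U * (μ[g|coarseSigma W β M]) U) ∂μ|
          + |cov[F, Gc; μ]| := abs_add_le _ _
    _ ≤ c₀ * Sf * Sg * Real.exp (-m * n) + (|cov[F - Hf, Gc; μ]| + |cov[Hf, Gc - Hg; μ]| + |cov[Hf, Hg; μ]|) := by
          refine add_le_add hT1 ?_
          rw [hsplit]
          exact (abs_add_le _ _).trans (add_le_add (abs_add_le _ _) le_rfl)
    _ ≤ c₀ * Sf * Sg * Real.exp (-m * n) +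
          (2 * (c₀ * Sf * (Real.exp κ * Real.exp (-m * n))) * (2 * (D₀ * Sg)) +
            2 * (c₀ * Sg * (Real.exp κ * Real.exp (-m * n))) * (2 * (D₀ * (c₀ * Sf))) +
            A₀ * (c₀ * Sf) * (c₀ * Sg) * (Real.exp (2 * m_c) * Real.exp (-m * n))) :=
          add_le_add le_rfl (add_le_add (add_le_add hT2 hT3) hT4)
    _ = (c₀ + 4 * c₀ * D₀ * Real.exp κ * (1 + c₀) + A₀ * c₀ ^ 2 * Real.exp (2 * m_c)) * Sf * Sg *
          Real.exp (-m * n) := by ring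
    _ = (c₀ + 4 * c₀ * D₀ * Real.exp κ * (1 + c₀) + A₀ * c₀ ^ 2 * Real.exp (2 * m_c)) *
          (∑ x ∈ Δf, δf x) * (∑ y ∈ Δg, δg y) * Real.exp (-(min m_c κ / (3 * W.factor β)) * n) := by
          rw [hSf, hSg, hm_def]

/-- **`DecayTransfer` holds** for a continuous representation `ρ` and nonnegative rates `κ, m_c` (the fine Wilson laws
are then probability measures, `isProbabilityMeasure_wilsonMeasure`). [folklore] -/
theorem decayTransfer {ρ : G →* Matrix (Fin N) (Fin N) ℂ} (hρ : Continuous ρ) {r : G → G → ℝ}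
    {W : BlockFamily G} {I : Set ℝ} {m_c κ : ℝ} (hκ : 0 ≤ κ) (hmc : 0 ≤ m_c) :
    DecayTransfer r ρ W I m_c κ :=
  decayTransfer_of (fun β M _ => Or.inl (isProbabilityMeasure_wilsonMeasure (d := 3) (L := W.factor β * M) ρ hρ β))
    hκ hmc

/-! ### Consequences for the statement of `T_IR`: the support hypothesis is discharged -/

/-- **`T_IR` reduces to the quotable conjecture `IRConjecture3`** (for a continuous representation and
nonnegative rates): the support clause `DecayTransfer` of `T_IR` holds for EVERY block family by `decayTransfer`,
so `IRConjecture3 B r ρ I C_b κ → T_IR mk B r ρ I C_b κ m_c` (`t_IR_of_conjecture`). [folklore] -/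
theorem t_IR_of_irConjecture3 {L : ℕ} {B : BallSpec G N} {r : G → G → ℝ} {ρ : G →* Matrix (Fin N) (Fin N) ℂ}
    {I : Set ℝ} {C_b κ m_c : ℝ} (hρ : Continuous ρ) (hκ : 0 ≤ κ) (hmc : 0 ≤ m_c)
    (mk : Balaban1985CMP102.Theorems.Construction L) (h : IRConjecture3 B r ρ I C_b κ) : T_IR mk B r ρ I C_b κ m_c :=
  t_IR_of_conjecture mk h fun _ => decayTransfer hρ hκ hmc

/-- **The composition with the support hypothesis DISCHARGED:
`BalabanUV3 ∧ ClusterDomainClustering ∧ IRConjecture3 ⟹ MassGap3Cofinal I`** — every remaining hypothesis is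
IN PRINT (`BalabanUV3`, by name from the tree), Y2's theorem-to-be (`ClusterDomainClustering`) or the ONE named
conjecture `IRConjecture3`; `ρ` continuous, rates and `C_b` positive, `I` unbounded, `r` bounded above.  Bookkeeping
on `massGap3Cofinal_of`; NOT a proof of a mass gap. [folklore] -/
theorem massGap3Cofinal_of_irConjecture3 {L : ℕ} {mk : Balaban1985CMP102.Theorems.Construction L}
    {B : BallSpec G N} {r : G → G → ℝ} {ρ : G →* Matrix (Fin N) (Fin N) ℂ} {I : Set ℝ} {C_b κ m_c : ℝ}
    (hρ : Continuous ρ) (hI : ¬ BddAbove I) (hC : 0 < C_b) (hκ : 0 < κ) (hm : 0 < m_c)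
    (hr : ∃ D : ℝ, ∀ a b : G, r a b ≤ D) (hUV : BalabanUV3 mk) (hRB : ClusterDomainClustering B r m_c)
    (hIR : IRConjecture3 B r ρ I C_b κ) : MassGap3Cofinal I r ρ :=
  massGap3Cofinal_of hI hC hκ hm hr hUV hRB (t_IR_of_irConjecture3 hρ hκ.le hm.le mk hIR)

end Main

end Summit.Ventures.YMGap.YM3IR.DecayTransferProof

end
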